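import Summits.QuantumFields.YangMills.Theorems.FradkinShenkerFlowFiniteSusceptibilityWeakCouplingAutParity
import HarnessLib

/-!
# Crux `FiniteSusceptibilityWeakCoupling` (stmt-QuantumFields-9442), line `purity-rate-split` —
# the crux's susceptibility clause cuts losslessly along any involutive global automorphism (charge-conjugation parity)

Third file of the automorphism-sector bookkeeping (`…AutomorphismSector`: invariance of the torus Wilson state, selection
rule for connected TIME-correlations; `…AutParity`: the cut of the purity half, item stmt-QuantumFields-18060). Here the
selection rule is proved in COVARIANCE form for translates in EVERY lattice direction and on EVERY torus (the form in which
the crux `Summit.QuantumFields.YangMills.Theses.FradkinShenkerFlow.FiniteSusceptibilityWeakCoupling` and the conclusion of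
its rate half `DecorrelationForcesSummability`, item stmt-QuantumFields-18061, are typed), and the crux's inner clause at fixed
`(G, r, β)` — "`Σ_{x ∈ box 4 S} |Cov_{β,S}(A∘lift, B∘τ_{-x}∘lift)|` bounded uniformly in `S`, for all species `A, B`" — is cut:

* `AutSectorClause.cov_selection` — for a character-preserving bi-continuous automorphism `φ`, a `φ`-even species `P` and a
  `φ`-odd species `M`: `Cov_{β,L}(P∘lift, M∘τ_x∘lift) = 0 = Cov_{β,L}(M∘lift, P∘τ_x∘lift)` for every side `L`, every `x ∈ ℤ⁴`,
  every real `β` (`covariance_map_equiv` under the measure-preserving link-wise map, which commutes with lift and translations);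
* `AutSectorClause.four_mul_cov_eq` — for involutive `φ`: `4·Cov(A∘lift, B∘τ_x∘lift) = Cov(P_A∘lift, P_B∘τ_x∘lift) + Cov(M_A∘lift, M_B∘τ_x∘lift)`
  with `P_X = X + X∘φ`, `M_X = X − X∘φ`;
* `stub_fsClause_iff_autParity` (registered on stmt-QuantumFields-9442) — **the cut of the crux's clause**: at fixed `(G, r, β)`
  and for every involutive character-preserving bi-continuous `φ`, the clause for ALL pairs of species holds iff it holds for the
  pairs of `φ`-EVEN species and for the pairs of `φ`-ODD species. By `AutSector.exists_suConj` this is the charge-conjugation cut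
  of the crux (and of the conclusion of its rate half) for `SU(N)` with the fundamental Wilson action; for `SU(2)` the odd sector is
  empty (`su2_species_conj_even`), for `SU(N ≥ 3)` the `(C-odd, C-odd)` pair sector is exactly where the `U(1)₄`-type
  counter-mechanism of `STRATEGY-CENSUS.md` §N10 (an emergent photon seen by a `C`-odd bounded local functional) would have to live.

No engine; `--supports` the crux. Mathlib + tree only.
-/

set_option autoImplicit false

noncomputable section

open MeasureTheory ProbabilityTheory Finset
open Literature.MathematicalPhysics.QuantumFieldTheory hiding Site ZdEdge
open Literature.MathematicalPhysics.QuantumLattice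
open Literature.Probability.LatticeModels hiding configShift configShift_apply

namespace Summit.QuantumFields.YangMills.Theorems.FiniteSusceptibilityWeakCoupling

namespace AutSectorClause

variable {G : Type} [Group G] [TopologicalSpace G] [IsTopologicalGroup G] [CompactSpace G]
  [MeasurableSpace G] [BorelSpace G]

/-- **Selection rule, covariance form** (every compact `G`, every `r`, every real `β`, every torus side `L`, every lattice
vector `x`): for a character-preserving bi-continuous automorphism `φ` acting link-wise, a `φ`-even species `P` and a `φ`-odd
species `M` have `Cov_{β,L}(P∘lift, M∘τ_x∘lift) = 0` and `Cov_{β,L}(M∘lift, P∘τ_x∘lift) = 0`. [folklore] -/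
theorem cov_selection (r : LatticeRep G) (β : ℝ) (φ : G ≃* G) (hφ : Continuous φ) (hφs : Continuous φ.symm)
    (hρφ : ∀ g, (r.ρ (φ g)).trace.re = (r.ρ g).trace.re) (P M : YMSpecies G)
    (hP : ∀ V, P.F (fun e => φ (V e)) = P.F V) (hM : ∀ V, M.F (fun e => φ (V e)) = -M.F V)
    (L : ℕ) [NeZero L] (x : Literature.Probability.LatticeModels.Site 4) :
    cov[fun U => P.F (torusLift L U), fun U => M.F (configShift x (torusLift L U));
        wilsonMeasure (d := 4) (L := L) r.ρ β] = 0 ∧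
      cov[fun U => M.F (torusLift L U), fun U => P.F (configShift x (torusLift L U));
        wilsonMeasure (d := 4) (L := L) r.ρ β] = 0 := by
  have hmap := AutSector.wilsonMeasure_map_aut (d := 4) (L := L) r.ρ β φ hφ hφs hρφ
  -- the four compositions with the link-wise map
  have eP : ((fun U : GaugeConfig 4 L G => P.F (torusLift L U)) ∘
      ⇑(MeasurableEquiv.arrowCongr' (Equiv.refl (Edge 4 L)) ((Homeomorph.mk φ.toEquiv hφ hφs).toMeasurableEquiv))) =
      fun U => P.F (torusLift L U) := by
    funext U
    simp only [Function.comp_apply]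
    rw [AutSector.arrowCongr'_apply, AutSector.torusLift_aut, hP]
  have eM : ((fun U : GaugeConfig 4 L G => M.F (torusLift L U)) ∘
      ⇑(MeasurableEquiv.arrowCongr' (Equiv.refl (Edge 4 L)) ((Homeomorph.mk φ.toEquiv hφ hφs).toMeasurableEquiv))) =
      fun U => -M.F (torusLift L U) := by
    funext U
    simp only [Function.comp_apply]
    rw [AutSector.arrowCongr'_apply, AutSector.torusLift_aut, hM]
  have eMx : ((fun U : GaugeConfig 4 L G => M.F (configShift x (torusLift L U))) ∘
      ⇑(MeasurableEquiv.arrowCongr' (Equiv.refl (Edge 4 L)) ((Homeomorph.mk φ.toEquiv hφ hφs).toMeasurableEquiv))) =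
      fun U => -M.F (configShift x (torusLift L U)) := by
    funext U
    simp only [Function.comp_apply]
    rw [AutSector.arrowCongr'_apply, AutSector.torusLift_aut, AutSector.configShift_aut, hM]
  have ePx : ((fun U : GaugeConfig 4 L G => P.F (configShift x (torusLift L U))) ∘
      ⇑(MeasurableEquiv.arrowCongr' (Equiv.refl (Edge 4 L)) ((Homeomorph.mk φ.toEquiv hφ hφs).toMeasurableEquiv))) =
      fun U => P.F (configShift x (torusLift L U)) := by
    funext U
    simp only [Function.comp_apply]
    rw [AutSector.arrowCongr'_apply, AutSector.torusLift_aut, AutSector.configShift_aut, hP]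
  constructor
  · have key := covariance_map_equiv (μ := wilsonMeasure (d := 4) (L := L) r.ρ β)
      (fun U : GaugeConfig 4 L G => P.F (torusLift L U)) (fun U => M.F (configShift x (torusLift L U)))
      (MeasurableEquiv.arrowCongr' (Equiv.refl (Edge 4 L)) ((Homeomorph.mk φ.toEquiv hφ hφs).toMeasurableEquiv))
    rw [hmap, eP, eMx, covariance_fun_neg_right] at key
    linarith
  · have key := covariance_map_equiv (μ := wilsonMeasure (d := 4) (L := L) r.ρ β)
      (fun U : GaugeConfig 4 L G => M.F (torusLift L U)) (fun U => P.F (configShift x (torusLift L U)))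
      (MeasurableEquiv.arrowCongr' (Equiv.refl (Edge 4 L)) ((Homeomorph.mk φ.toEquiv hφ hφs).toMeasurableEquiv))
    rw [hmap, eM, ePx, covariance_fun_neg_left] at key
    linarith

/-- **Polarisation of the two-species covariance along an involutive automorphism** (every odd torus, every `x ∈ ℤ⁴`, every
real `β`): with `P_X = X + X∘φ`, `M_X = X − X∘φ`,
`4·Cov(A∘lift, B∘τ_x∘lift) = Cov(P_A∘lift, P_B∘τ_x∘lift) + Cov(M_A∘lift, M_B∘τ_x∘lift)` — bilinearity plus the covariance
selection rule for the two mixed terms. [folklore] -/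
theorem four_mul_cov_eq (r : LatticeRep G) (β : ℝ) (φ : G ≃* G) (hφ : Continuous φ) (hφs : Continuous φ.symm)
    (hρφ : ∀ g, (r.ρ (φ g)).trace.re = (r.ρ g).trace.re) (hφ2 : Function.Involutive φ)
    (A PA MA B PB MB : YMSpecies G)
    (hPA : ∀ V, PA.F V = A.F V + A.F (fun e => φ (V e))) (hMA : ∀ V, MA.F V = A.F V - A.F (fun e => φ (V e)))
    (hPB : ∀ V, PB.F V = B.F V + B.F (fun e => φ (V e))) (hMB : ∀ V, MB.F V = B.F V - B.F (fun e => φ (V e)))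
    (S : ℕ) (x : Literature.Probability.LatticeModels.Site 4) :
    4 * cov[fun U => A.F (torusLift (2 * S + 1) U), fun U => B.F (configShift x (torusLift (2 * S + 1) U));
        wilsonMeasure (d := 4) (L := 2 * S + 1) r.ρ β] =
      cov[fun U => PA.F (torusLift (2 * S + 1) U), fun U => PB.F (configShift x (torusLift (2 * S + 1) U));
          wilsonMeasure (d := 4) (L := 2 * S + 1) r.ρ β] +
        cov[fun U => MA.F (torusLift (2 * S + 1) U), fun U => MB.F (configShift x (torusLift (2 * S + 1) U));
          wilsonMeasure (d := 4) (L := 2 * S + 1) r.ρ β] := by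
  haveI : IsProbabilityMeasure (wilsonMeasure (d := 4) (L := 2 * S + 1) r.ρ β) :=
    isProbabilityMeasure_wilsonMeasure _ r.continuous β
  obtain ⟨hPAe, hMAo⟩ := AutParity.parts_parity φ hφ2 hPA hMA
  obtain ⟨hPBe, hMBo⟩ := AutParity.parts_parity φ hφ2 hPB hMB
  obtain ⟨hPM, -⟩ := cov_selection r β φ hφ hφs hρφ PA MB hPAe hMBo (2 * S + 1) x
  obtain ⟨hMP, -⟩ := cov_selection r β φ hφ hφs hρφ PB MA hPBe hMAo (2 * S + 1) x
  set fP : GaugeConfig 4 (2 * S + 1) G → ℝ := fun U => PA.F (torusLift (2 * S + 1) U) with hfP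
  set fM : GaugeConfig 4 (2 * S + 1) G → ℝ := fun U => MA.F (torusLift (2 * S + 1) U) with hfM
  set gP : GaugeConfig 4 (2 * S + 1) G → ℝ := fun U => PB.F (configShift x (torusLift (2 * S + 1) U)) with hgP
  set gM : GaugeConfig 4 (2 * S + 1) G → ℝ := fun U => MB.F (configShift x (torusLift (2 * S + 1) U)) with hgM
  have hfA : (fun U : GaugeConfig 4 (2 * S + 1) G => A.F (torusLift (2 * S + 1) U)) = (1 / 2 : ℝ) • (fP + fM) := by
    funext U
    simp only [hfP, hfM, Pi.smul_apply, Pi.add_apply, smul_eq_mul]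
    linarith [hPA (torusLift (2 * S + 1) U), hMA (torusLift (2 * S + 1) U)]
  have hgB : (fun U : GaugeConfig 4 (2 * S + 1) G => B.F (configShift x (torusLift (2 * S + 1) U))) =
      (1 / 2 : ℝ) • (gP + gM) := by
    funext U
    simp only [hgP, hgM, Pi.smul_apply, Pi.add_apply, smul_eq_mul]
    linarith [hPB (configShift x (torusLift (2 * S + 1) U)), hMB (configShift x (torusLift (2 * S + 1) U))]
  have mfP : MemLp fP 2 (wilsonMeasure (d := 4) (L := 2 * S + 1) r.ρ β) := EvenReduction.memLp_lift r β PA S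
  have mfM : MemLp fM 2 (wilsonMeasure (d := 4) (L := 2 * S + 1) r.ρ β) := EvenReduction.memLp_lift r β MA S
  have mgP : MemLp gP 2 (wilsonMeasure (d := 4) (L := 2 * S + 1) r.ρ β) := EvenReduction.memLp_shift_lift r β PB S _
  have mgM : MemLp gM 2 (wilsonMeasure (d := 4) (L := 2 * S + 1) r.ρ β) := EvenReduction.memLp_shift_lift r β MB S _
  -- the swapped mixed term `Cov(M_A∘lift, P_B∘τ∘lift)` is the second component of the selection rule for `(P_B, M_A)`
  obtain ⟨-, hMP'⟩ := cov_selection r β φ hφ hφs hρφ PB MA hPBe hMAo (2 * S + 1) x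
  rw [hfA, hgB, covariance_smul_left, covariance_smul_right, covariance_add_left mfP mfM (mgP.add mgM),
    covariance_add_right mfP mgP mgM, covariance_add_right mfM mgP mgM]
  have h1 : cov[fP, gM; wilsonMeasure (d := 4) (L := 2 * S + 1) r.ρ β] = 0 := hPM
  have h2 : cov[fM, gP; wilsonMeasure (d := 4) (L := 2 * S + 1) r.ρ β] = 0 := hMP'
  rw [h1, h2]
  ring

end AutSectorClause

/-- **Registered stub `stub_fsClause_iff_autParity`** of item stmt-QuantumFields-9442, line `purity-rate-split` (signature
verbatim, fully qualified) — **the crux's susceptibility clause cuts losslessly along any involutive character-preserving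
automorphism**: for every compact `G`, lattice representation `r`, real `β` and bi-continuous involutive automorphism `φ` with
`Re tr r.ρ (φ g) = Re tr r.ρ g`, the inner clause of `FiniteSusceptibilityWeakCoupling` at `(G, r, β)` for ALL pairs of species
holds iff it holds for the pairs of `φ`-even species and for the pairs of `φ`-odd species. `⇒` is restriction; `⇐` splits
`A, B` into `φ`-parts (`AutParity.exists_autParts`) and uses `4·|Cov(A, τB)| ≤ |Cov(P_A, τP_B)| + |Cov(M_A, τM_B)|`
(`AutSectorClause.four_mul_cov_eq`) term by term. [folklore] -/
theorem stub_fsClause_iff_autParity : ∀ (G : Type) [Group G] [TopologicalSpace G] [IsTopologicalGroup G] [CompactSpace G] [MeasurableSpace G] [BorelSpace G] (r : Literature.MathematicalPhysics.QuantumFieldTheory.LatticeRep G) (β : ℝ) (φ : G ≃* G), Continuous φ → Continuous φ.symm → Function.Involutive φ → (∀ g, ((r.ρ (φ g)).trace).re = ((r.ρ g).trace).re) → ((∀ A B : Literature.MathematicalPhysics.QuantumFieldTheory.YMSpecies G, ∃ χ : ℝ, ∀ S : ℕ, ∑ x ∈ Literature.Probability.LatticeModels.box 4 S, |ProbabilityTheory.covariance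 (fun U => A.F (Literature.MathematicalPhysics.QuantumLattice.torusLift (2 * S + 1) U)) (fun U => B.F (Literature.MathematicalPhysics.QuantumLattice.configShift (-x) (Literature.MathematicalPhysics.QuantumLattice.torusLift (2 * S + 1) U))) (Literature.MathematicalPhysics.QuantumFieldTheory.wilsonMeasure r.ρ β)| ≤ χ) ↔ ((∀ A B : Literature.MathematicalPhysics.QuantumFieldTheory.YMSpecies G, (∀ V, A.F (fun e => φ (V e)) = A.F V) → (∀ V, B.F (fun e => φ (V e)) = B.F V) → ∃ χ : ℝ, ∀ S : ℕ, ∑ x ∈ Literature.Probability.LatticeModels.box 4 S, |ProbabilityTheory.covariance (fun U => A.F (Literature.MathematicalPhysics.QuantumLattice.torusLift (2 * S + 1) U)) (fun U => B.F (Literature.MathematicalPhysics.QuantumLattice.configShift (-x) (Literature.MathematicalPhysics.QuantumLattice.torusLift (2 * S + 1) U))) (Literature.MathematicalPhysics.QuantumFieldTheory.wilsonMeasure r.ρ β)| ≤ χ) ∧ (∀ A B : Literature.MathematicalPhysics.QuantumFieldTheory.YMSpecies G, (∀ V, A.F (fun e => φ (V e)) = -A.F V) → (∀ V, B.F (fun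 e => φ (V e)) = -B.F V) → ∃ χ : ℝ, ∀ S : ℕ, ∑ x ∈ Literature.Probability.LatticeModels.box 4 S, |ProbabilityTheory.covariance (fun U => A.F (Literature.MathematicalPhysics.QuantumLattice.torusLift (2 * S + 1) U)) (fun U => B.F (Literature.MathematicalPhysics.QuantumLattice.configShift (-x) (Literature.MathematicalPhysics.QuantumLattice.torusLift (2 * S + 1) U))) (Literature.MathematicalPhysics.QuantumFieldTheory.wilsonMeasure r.ρ β)| ≤ χ))) := by
  intro G _ _ _ _ _ _ r β φ hφ hφs hφ2 hρφ
  refine ⟨fun h => ⟨fun A B _ _ => h A B, fun A B _ _ => h A B⟩, fun h A B => ?_⟩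
  obtain ⟨hE, hO⟩ := h
  obtain ⟨PA, MA, hPA, hMA⟩ := AutParity.exists_autParts φ hφ.measurable A
  obtain ⟨PB, MB, hPB, hMB⟩ := AutParity.exists_autParts φ hφ.measurable B
  obtain ⟨hPAe, hMAo⟩ := AutParity.parts_parity φ hφ2 hPA hMA
  obtain ⟨hPBe, hMBo⟩ := AutParity.parts_parity φ hφ2 hPB hMB
  obtain ⟨χ₁, hχ₁⟩ := hE PA PB hPAe hPBe
  obtain ⟨χ₂, hχ₂⟩ := hO MA MB hMAo hMBo
  refine ⟨(χ₁ + χ₂) / 4, fun S => ?_⟩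
  have hterm : ∀ x ∈ box 4 S,
      |cov[fun U => A.F (torusLift (2 * S + 1) U), fun U => B.F (configShift (-x) (torusLift (2 * S + 1) U));
          wilsonMeasure (d := 4) (L := 2 * S + 1) r.ρ β]| ≤
        (|cov[fun U => PA.F (torusLift (2 * S + 1) U), fun U => PB.F (configShift (-x) (torusLift (2 * S + 1) U));
            wilsonMeasure (d := 4) (L := 2 * S + 1) r.ρ β]| +
          |cov[fun U => MA.F (torusLift (2 * S + 1) U), fun U => MB.F (configShift (-x) (torusLift (2 * S + 1) U));
            wilsonMeasure (d := 4) (L := 2 * S + 1) r.ρ β]|) / 4 := by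
    intro x _
    have h4 := AutSectorClause.four_mul_cov_eq r β φ hφ hφs hρφ hφ2 A PA MA B PB MB hPA hMA hPB hMB S (-x)
    rw [le_div_iff₀ (by norm_num : (0 : ℝ) < 4), mul_comm,
      show (4 : ℝ) * |cov[fun U => A.F (torusLift (2 * S + 1) U),
          fun U => B.F (configShift (-x) (torusLift (2 * S + 1) U)); wilsonMeasure (d := 4) (L := 2 * S + 1) r.ρ β]| =
        |4 * cov[fun U => A.F (torusLift (2 * S + 1) U),
          fun U => B.F (configShift (-x) (torusLift (2 * S + 1) U)); wilsonMeasure (d := 4) (L := 2 * S + 1) r.ρ β]| by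
        rw [abs_mul, abs_of_pos (by norm_num : (0 : ℝ) < 4)], h4]
    exact abs_add_le _ _
  calc ∑ x ∈ box 4 S, |cov[fun U => A.F (torusLift (2 * S + 1) U),
          fun U => B.F (configShift (-x) (torusLift (2 * S + 1) U)); wilsonMeasure (d := 4) (L := 2 * S + 1) r.ρ β]|
      ≤ ∑ x ∈ box 4 S, (|cov[fun U => PA.F (torusLift (2 * S + 1) U),
            fun U => PB.F (configShift (-x) (torusLift (2 * S + 1) U)); wilsonMeasure (d := 4) (L := 2 * S + 1) r.ρ β]| +
          |cov[fun U => MA.F (torusLift (2 * S + 1) U),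
            fun U => MB.F (configShift (-x) (torusLift (2 * S + 1) U)); wilsonMeasure (d := 4) (L := 2 * S + 1) r.ρ β]|) / 4 :=
        sum_le_sum hterm
    _ = (∑ x ∈ box 4 S, |cov[fun U => PA.F (torusLift (2 * S + 1) U),
            fun U => PB.F (configShift (-x) (torusLift (2 * S + 1) U)); wilsonMeasure (d := 4) (L := 2 * S + 1) r.ρ β]| +
          ∑ x ∈ box 4 S, |cov[fun U => MA.F (torusLift (2 * S + 1) U),
            fun U => MB.F (configShift (-x) (torusLift (2 * S + 1) U)); wilsonMeasure (d := 4) (L := 2 * S + 1) r.ρ β]|) / 4 := by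
        rw [← sum_div, sum_add_distrib]
    _ ≤ (χ₁ + χ₂) / 4 := by
        have a := hχ₁ S
        have b := hχ₂ S
        exact div_le_div_of_nonneg_right (add_le_add a b) (by norm_num)

end Summit.QuantumFields.YangMills.Theorems.FiniteSusceptibilityWeakCoupling

end
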